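/-
Copyright (c) 2026. All rights reserved.
Released under Apache 2.0 license as described in the file LICENSE.
Authors: abc-iut cell, fact-proving seat abc-iut-f-102 (block F, tranche 102).
-/
import Literature.AnabelianGeometry.AbsoluteAnabelian.DiagramMorphismPathIso
import Literature.AnabelianGeometry.AbsoluteAnabelian.LogFrobeniusRigidityProofs
import HarnessLib

/-!
# [AbsTopIII] Corollary 5.5 (v), third clause REDUCED to shift-INVARIANCE of one family of homotopies (FACT-LIST row F-0157 without the apparatus of 1-morphisms and 2-morphisms of Def 3.5 (v))

S. Mochizuki, *Topics in absolute anabelian geometry III: global reconstruction algorithms*,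
J. Math. Sci. Univ. Tokyo 22 (2015) 939–1156 [MochizukiAbsTopIII2015]; locators `p.N` = pages of the
author's manuscript (`paper:url-5493eb38cbb7`): Def 3.5 (ii) p. 75 (families of homotopies), (v) pp. 76–77
(1-morphisms `Φ`, the isomorphisms `Φ_e`, "compatible with families of homotopies": `Φ_Γ⃗` induces a bijection of the
boundary sets and the `ζ_ϖ` are compatible with the `Φ_e`), Cor 5.5 (v) pp. 131–132 (the `ℤ`-action `⋎ ↦ ⋎ + k` on `D•` by
nexus-classes of self-equivalences "compatible with the families of homotopies that constitute the cores and observables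
of (i), (iii)"; proof p. 133: "immediate from the definitions").

PROOF-ONLY companion (no `def`, nothing restated) of `LogFrobeniusRigidity.lean` (abc-iut-L4-t3: `Cor55ShiftAction` =
F-0157, `RealisesCor55Families` = F-0159, the shift 1-morphisms `shiftOneMorphism k` with IDENTITY vertex functors
`shiftApp` and identity 2-cells), abc-iut-w5-d112's `LogFrobeniusRigidityProofs.lean` (`cor55ShiftAction_iff`,
`shiftOneMorphism_iso_eq`, `shiftGraph_comp`, `shiftGraph_zero`) and this seat's toolkit `DiagramMorphismPathIso.lean`
(`OneMorphism.pathIso`, `pathIso_hom_app_eq_eqToHom`, `CompatibleWith.pathIso_eq_pathIso`).  For EVERY setting `L`,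
every family `K` on `D•⊢` and every `k : ℤ`:

* `DVertex.shiftGraph_mapPath_cast` — the shift of `Γ⃗_{D•⊢}` is surjective on paths (inverse shift), so the
  "bijection between the boundary sets" of Def 3.5 (v) reduces to shift-STABILITY of `E_K`;
* `nonempty_shiftCompatibleWith_of_invariant` / `shiftInvariant_of_compatibleWith` — the shift `Φ = shiftOneMorphism k`
  is compatible with `K` in the sense of Def 3.5 (v) (`OneMorphism.CompatibleWith K K`) IF AND ONLY IF `K` is
  SHIFT-INVARIANT: (E) `(γ₁,γ₂) ∈ E_K ↔ (γ₁ + k, γ₂ + k) ∈ E_K`, and (ζ) the homotopy of the shifted pair has the same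
  components as that of the pair (heterogeneously — the categories at `𝒳_⋎` and `𝒳_{⋎+k}` are the same category).  The
  point: all `Φ_e` are identities, so the `Φ_{[γ]}` have `eqToHom` components and the compatibility square collapses;
* `cor55ShiftAction_iff_exists_shiftInvariant` — hence **F-0157 ⟺ some family `K` on `D•⊢` realises the cores of
  Cor 5.5 (i) and the observables of Cor 5.5 (iii) (`RealisesCor55Families K`, F-0159) AND is shift-invariant** — a
  statement about ONE family of homotopies, with no 1-morphisms, 2-cells or equivalences of diagrams left in it (the
  equivalence and group-law clauses being theorems for every `L`, w5-d112).

HONEST LABEL: a reduction of a TYPED statement; which `K` print intends (the families "that constitute the cores and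
observables") and that it is shift-invariant is print's "immediate from the definitions" (p. 133) — for the genuine data,
not for an arbitrary interface `L` (cf. `LogFrobeniusShiftActionIotaIso.lean`).  Refereed pre-IUT anabelian geometry;
nothing here bears on [IUTchIII] Cor. 3.12; typed ≠ proved.
-/

set_option autoImplicit false

universe u

open CategoryTheory Quiver

namespace Literature.AnabelianGeometry.AbsoluteAnabelian

/-! ## The shift of `Γ⃗_{D•⊢}` is surjective on paths -/

section Quivers

variable {W : Type*} [Quiver W]

/-- `mapPath` respects heterogeneous equality of paths with equal endpoints. [folklore] -/
private theorem Prefunctor.mapPath_heq'' (G : W ⥤q W) {a b a' b' : W} (ha : a = a') (hb : b = b') {p : Path a b}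
    {p' : Path a' b'} (h : HEq p p') : HEq (G.mapPath p) (G.mapPath p') := by
  subst ha hb; cases h; rfl

/-- equal morphisms of oriented graphs have heterogeneously equal actions on paths. [folklore] -/
private theorem Prefunctor.mapPath_heq_of_eq'' {P Q : W ⥤q W} (H : P = Q) {a b : W} (p : Path a b) :
    HEq (P.mapPath p) (Q.mapPath p) := by
  subst H; rfl

end Quivers

namespace DVertex

variable {Vmod : Type u} {isArc : Vmod → Bool}

/-- `shift (-k)` after `shift k` is the identity morphism of `Γ⃗_{D•⊢}`. [cite: MochizukiAbsTopIII2015, Cor 5.5 (v) p. 132] -/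
theorem shiftGraph_comp_neg (k : ℤ) :
    shiftGraph (Vmod := Vmod) (isArc := isArc) k ⋙q shiftGraph (-k) = 𝟭q (DVertex Vmod isArc) := by
  rw [shiftGraph_comp, Int.add_right_neg, shiftGraph_zero]

/-- `shift k` after `shift (-k)` is the identity morphism of `Γ⃗_{D•⊢}`. [cite: MochizukiAbsTopIII2015, Cor 5.5 (v) p. 132] -/
theorem shiftGraph_neg_comp (k : ℤ) :
    shiftGraph (Vmod := Vmod) (isArc := isArc) (-k) ⋙q shiftGraph k = 𝟭q (DVertex Vmod isArc) := by
  rw [shiftGraph_comp, Int.add_left_neg, shiftGraph_zero]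

/-- the vertices: `(x + k) - k = x`. [cite: MochizukiAbsTopIII2015, Cor 5.5 (v) p. 132] -/
theorem shift_shift_neg (k : ℤ) (x : DVertex Vmod isArc) : (x.shift k).shift (-k) = x :=
  congrArg (fun H : DVertex Vmod isArc ⥤q DVertex Vmod isArc => H.obj x) (shiftGraph_comp_neg (isArc := isArc) k)

/-- **The shift by `k` reaches every path between shifted vertices**: `Φ_Γ⃗ (Φ_Γ⃗⁻¹ γ') = γ'` — so `Φ_Γ⃗` induces a BIJECTION on
pairs of co-verticial paths, as Def 3.5 (v) ("induces a bijection between the boundary sets") requires, as soon as the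
boundary set is shift-stable. [cite: MochizukiAbsTopIII2015, Definition 3.5 (v) p.76] -/
theorem shiftGraph_mapPath_cast (k : ℤ) {a b : DVertex Vmod isArc} (p' : Path (a.shift k) (b.shift k)) :
    (shiftGraph k).mapPath (((shiftGraph (-k)).mapPath p').cast (shift_shift_neg k a) (shift_shift_neg k b)) = p' := by
  apply eq_of_heq
  refine (Prefunctor.mapPath_heq'' (shiftGraph k) (shift_shift_neg k a).symm (shift_shift_neg k b).symm
    (Path.cast_heq _ _ _)).trans ?_
  refine (heq_of_eq (Prefunctor.mapPath_comp_apply (shiftGraph (-k)) (shiftGraph k) p').symm).trans ?_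
  exact (Prefunctor.mapPath_heq_of_eq'' (shiftGraph_neg_comp k) p').trans (heq_of_eq (Prefunctor.mapPath_id p'))

end DVertex

/-- `f ≫ eqToHom = eqToHom ≫ g` from `HEq f g` (bookkeeping). [folklore] -/
private theorem comp_eqToHom_eq_eqToHom_comp_of_heq {C : Type*} [Category C] {A B A' B' : C} {f : A ⟶ B}
    {g : A' ⟶ B'} (hA : A = A') (hB : B = B') (H : HEq f g) : f ≫ eqToHom hB = eqToHom hA ≫ g := by
  subst hA hB
  cases H
  simp

/-- `HEq f g` from `f ≫ eqToHom = eqToHom ≫ g` (bookkeeping). [folklore] -/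
private theorem heq_of_comp_eqToHom_eq_eqToHom_comp {C : Type*} [Category C] {A B A' B' : C} {f : A ⟶ B}
    {g : A' ⟶ B'} (hA : A = A') (hB : B = B') (h : f ≫ eqToHom hB = eqToHom hA ≫ g) : HEq f g := by
  subst hA hB
  simp only [eqToHom_refl, Category.comp_id, Category.id_comp] at h
  exact heq_of_eq h

namespace LogFrobeniusSetting

open DiagramOfCategories

variable {Vmod : Type u} {isArc : Vmod → Bool} (L : LogFrobeniusSetting Vmod isArc)

/-- The vertex functors of the shift are identity functors: they do not change morphisms (heterogeneously — the
categories at `x` and `x + k` coincide). [cite: MochizukiAbsTopIII2015, Cor 5.5 (v) p. 132] -/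
theorem shiftApp_map_heq (k : ℤ) (b : DVertex Vmod isArc) {X Y : L.diagram.obj b} (m : X ⟶ Y) :
    HEq ((L.shiftApp k b).map m) m := by
  cases b <;> exact HEq.rfl

/-! ## Compatibility of the shift with a family of homotopies = shift-invariance of the family -/

/-- **Shift-invariance implies Def 3.5 (v) compatibility.**  If the boundary set of `K` is stable under the shift by `k`
and the homotopy of each shifted pair has the components of the homotopy of the pair (heterogeneously, through the
identity vertex functors), then the shift 1-morphism `shiftOneMorphism k` is COMPATIBLE with `K` (on both sides): the
bijection of boundary sets is stability + surjectivity of the shift on paths, and — all 2-cells of the shift being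
identities, so that the `Φ_{[γ]}` have `eqToHom` components — the compatibility square of the homotopies reduces to the
invariance. [cite: MochizukiAbsTopIII2015, Definition 3.5 (v) p.76] -/
theorem nonempty_shiftCompatibleWith_of_invariant (K : L.diagram.HomotopyFamily) (k : ℤ)
    (hE : ∀ ⦃a b : DVertex Vmod isArc⦄ (p q : Path a b),
      K.E p q ↔ K.E ((DVertex.shiftGraph k).mapPath p) ((DVertex.shiftGraph k).mapPath q))
    (hη : ∀ ⦃a b : DVertex Vmod isArc⦄ (p q : Path a b) (h : K.E p q)
      (h' : K.E ((DVertex.shiftGraph k).mapPath p) ((DVertex.shiftGraph k).mapPath q)) (x : L.diagram.obj a),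
      HEq ((K.η h').app ((L.shiftApp k a).obj x)) ((K.η h).app x)) :
    Nonempty ((L.shiftOneMorphism k).CompatibleWith K K) := by
  refine ⟨{ pathIso := fun p => (L.shiftOneMorphism k).pathIso p
            pathIso_nil := fun a => OneMorphism.pathIso_nil _ a
            pathIso_cons := fun p e => OneMorphism.pathIso_cons _ p e
            boundary_iff := fun p q => hE p q
            boundary_surj := fun p' q' _ =>
              ⟨_, _, DVertex.shiftGraph_mapPath_cast k p', DVertex.shiftGraph_mapPath_cast k q'⟩
            η_compat := fun {a b} p q h => ?_ }⟩
  ext x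
  obtain ⟨h₁, h₂, e₁, e₂⟩ := OneMorphism.exists_pathIso_hom_app_eq (L.shiftOneMorphism k)
    (fun e => L.shiftOneMorphism_iso_eq k e) p q x
  rw [NatTrans.comp_app, NatTrans.comp_app, Functor.whiskerLeft_app, Functor.whiskerRight_app, e₁, e₂]
  have H : HEq ((K.η ((hE p q).mp h)).app (((L.shiftOneMorphism k).app a).obj x))
      (((L.shiftOneMorphism k).app b).map ((K.η h).app x)) :=
    (hη p q h _ x).trans (L.shiftApp_map_heq k b _).symm
  exact comp_eqToHom_eq_eqToHom_comp_of_heq h₁ h₂ H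

/-- **Def 3.5 (v) compatibility implies shift-invariance** (converse): from a compatibility witness of the shift by `k`
with `K`, the boundary set of `K` is shift-stable and the homotopies of shifted pairs have the components of the original
ones (the witness's `Φ_{[γ]}` are the canonical ones — `CompatibleWith.pathIso_eq_pathIso` — with `eqToHom` components).
[cite: MochizukiAbsTopIII2015, Definition 3.5 (v) p.76] -/
theorem shiftInvariant_of_compatibleWith (K : L.diagram.HomotopyFamily) (k : ℤ)
    (Ψ : (L.shiftOneMorphism k).CompatibleWith K K) :
    (∀ ⦃a b : DVertex Vmod isArc⦄ (p q : Path a b),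
        K.E p q ↔ K.E ((DVertex.shiftGraph k).mapPath p) ((DVertex.shiftGraph k).mapPath q)) ∧
      ∀ ⦃a b : DVertex Vmod isArc⦄ (p q : Path a b) (h : K.E p q)
        (h' : K.E ((DVertex.shiftGraph k).mapPath p) ((DVertex.shiftGraph k).mapPath q)) (x : L.diagram.obj a),
        HEq ((K.η h').app ((L.shiftApp k a).obj x)) ((K.η h).app x) := by
  refine ⟨fun a b p q => Ψ.boundary_iff p q, fun a b p q h h' x => ?_⟩
  have hc := NatTrans.congr_app (Ψ.η_compat p q h) x
  rw [NatTrans.comp_app, NatTrans.comp_app, Functor.whiskerLeft_app, Functor.whiskerRight_app,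
    Ψ.pathIso_eq_pathIso p, Ψ.pathIso_eq_pathIso q] at hc
  obtain ⟨h₁, h₂, e₁, e₂⟩ := OneMorphism.exists_pathIso_hom_app_eq (L.shiftOneMorphism k)
    (fun e => L.shiftOneMorphism_iso_eq k e) p q x
  rw [e₁, e₂] at hc
  -- `hc : ζ'_x ≫ eqToHom h₂ = eqToHom h₁ ≫ Φ_b (ζ_x)`
  exact (heq_of_comp_eqToHom_eq_eqToHom_comp h₁ h₂ hc).trans (L.shiftApp_map_heq k b _)

/-! ## F-0157 reduced to one shift-invariant realising family -/

/-- **Cor 5.5 (v), third clause (F-0157) ⟺ a SHIFT-INVARIANT family of homotopies on `D•⊢` realises the cores of (i) and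
the observables of (iii).**  `Cor55ShiftAction L` holds iff some `K` with `RealisesCor55Families K` (F-0159) has, for
every `k`, a shift-stable boundary set and shift-invariant homotopies — no 1-morphisms, 2-cells or equivalences of diagrams
remain in the statement (those clauses hold for every setting, abc-iut-w5-d112's `cor55ShiftAction_iff`).
[cite: MochizukiAbsTopIII2015, Cor 5.5 (v) pp. 131–133] -/
theorem cor55ShiftAction_iff_exists_shiftInvariant : L.Cor55ShiftAction ↔
    ∃ K : L.diagram.HomotopyFamily, L.RealisesCor55Families K ∧ ∀ k : ℤ,
      (∀ ⦃a b : DVertex Vmod isArc⦄ (p q : Path a b),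
          K.E p q ↔ K.E ((DVertex.shiftGraph k).mapPath p) ((DVertex.shiftGraph k).mapPath q)) ∧
        ∀ ⦃a b : DVertex Vmod isArc⦄ (p q : Path a b) (h : K.E p q)
          (h' : K.E ((DVertex.shiftGraph k).mapPath p) ((DVertex.shiftGraph k).mapPath q)) (x : L.diagram.obj a),
          HEq ((K.η h').app ((L.shiftApp k a).obj x)) ((K.η h).app x) := by
  rw [L.cor55ShiftAction_iff]
  refine ⟨fun ⟨K, hK, hc⟩ => ⟨K, hK, fun k => ?_⟩, fun ⟨K, hK, hinv⟩ => ⟨K, hK, fun k => ?_⟩⟩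
  · obtain ⟨Ψ⟩ := hc k
    exact L.shiftInvariant_of_compatibleWith K k Ψ
  · exact L.nonempty_shiftCompatibleWith_of_invariant K k (hinv k).1 (hinv k).2

end LogFrobeniusSetting

end Literature.AnabelianGeometry.AbsoluteAnabelian
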